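import Literature.Probability.RandomPlanarGeometry.HexSAWRotSurfaceFugacity
import Literature.Probability.RandomPlanarGeometry.HexSAWRotStripHeightOne
import HarnessLib

/-!
# A harmonic LOWER bound for Beaton's rotated-frame bridges at criticality: `B_H(x_c) ≥ 1/(2(H+1))`

Topic `Literature/Probability/RandomPlanarGeometry`; lane «pcv-sawmu», door «ROT-BRIDGE-LOWER» of planner a-idea-1 gen 24
(lens: bridge / renewal decompositions with explicit rates — here: the Duminil-Copin–Smirnov harmonic lower bound
`B_T ≥ c/T`, transported to Beaton's rotated strips with every constant certified).  CLASS S: imports only the tree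
(`HexSAWRotSurfaceFugacity` — Beaton's strip identity `HV.rotStrip_identity`, the last-contact cut `HV.rot_arch_cut_iSup`,
the lateral null limit `HV.tendsto_rotStripLat_zero`, `HV.iSup_rotStripBR_pos`, `HV.tendsto_rotStripBR`; and
`HexSAWRotStripHeightOne` for the height-one window).

Sources.  [DCS12] H. Duminil-Copin, S. Smirnov, *The connective constant of the honeycomb lattice equals `√(2+√2)`*,
Ann. of Math. 175 (2012) 1653–1665, §3, proof of Theorem 1 (the step `A_{T+1} − A_T ≤ x_c B_{T+1}²`, hence
"`B_T ≥ min[B_1, 1/(c_α x_c)]/T`" and `Z(x_c) = ∞`) — the MECHANISM, in the parallel frame (tree: `stripBlim_ge` of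
`HexSAWStripIdentity`).  [Bea14] N. R. Beaton, *The critical surface fugacity of self-avoiding walks on a rotated honeycomb
lattice*, J. Phys. A 47 (2014) 075003 (arXiv:1210.0274v3): §2.2 Proposition 4 / §4 identity (21) (the rotated strip identity
with coefficients `c_O = 2 sin(3π/16)`, `c_I = 2 sin(π/16)`, `c_E = 2 cos(3π/16)`, `c_B = 2 cos(π/16)`, `c_P = 2 cos(7π/16)`
and right side `2 x_c cos(π/16)` in the tree's normalisation), §4 proof of Proposition 11 (arXiv v3 p. 18, Figure 7: the
last-contact cut `X_{T+1} − X_T ≤ x_c⁻¹ B_{T+1} B_T` for the bottom classes, printed constant `(1+x_c)/2`; and the two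
displays `c_B B_T(x_c,1) − c_B(y) B_{T+1}(x_c,y) ≤ (c_A^O + c_A^I + c_P) B_{T+1}(x_c,y) B_T(x_c,1)`,
`0 ≤ 1/B_{T+1}(x_c,y) ≤ (c_A^O + c_A^I + c_P)/c_B + c_B(y)/(c_B B_T(x_c,1))`, of which T1–T2 below are the case `y = 1`
with the tree's cut constant — the induction on `T` that turns the second display at `y = 1` into `B_T ≥ c/T` is NOT
carried out in [Bea14], whose concern is `y ≠ 1`; [DCS12] carries it out in the parallel frame), §4 (arXiv v3 p. 17:
«B_T(x_c, 1) must decrease as T increases, and it too has a limit» — T10 below), Appendix Theorem 14 / Corollary 15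
(`B_T(x_c) → 0`; NO lower bound on `B_T` is stated in [Bea14]).  [MS93] N. Madras, G. Slade, *The Self-Avoiding Walk*, §1.2.

OBJECTS (tree): `B_{H,W} := HV.rotStripBR H W` = the generating function at `x = x_c`, `y = 1` of right-started walks of
Beaton's rotated strip domain `D(H, W)` from `a⁺` to the top row (Beaton's `B_{T,L}(x_c, 1)`, one half of his symmetric
class), non-decreasing in `W` with limit/supremum **`B_H := ⨆_W B_{H,W}`** (Beaton's `B_T(x_c) = lim_L B_{T,L}`), and
`E_{H,W}` the lateral class `HV.rotGF (D(H,W) ∖ {a⁻}) (IsRotLatDart H W)`.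

CONTENT (all at `x = x_c`, `y = 1`; `σ := c_O + c_I + c_P = 2 sin(3π/16) + 2 sin(π/16) + 2 cos(7π/16)`,
`κ := σ / (2 x_c cos(π/16)) = 1.78…`, certified `κ ≤ 9/5`):
* T0 `rotStripBR_step_finite` — the FINITE-WIDTH step: for `H, W ≥ 1`,
  `c_B B_{H,W} ≤ c_B B_{H+1,W} + σ x_c⁻¹ B_{H+1,W} · B_H + c_E E_{H+1,W}` (two strip identities at the same width, the
  three last-contact cuts, `E_{H,W} ≥ 0`);
* T1 `iSup_rotStripBR_step`, **`iSup_rotStripBR_sub_succ_le`** — `W → ∞` (`E_{H+1,W} → 0`):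
  `B_H − B_{H+1} ≤ κ · B_{H+1} · B_H`, and the numeral form `≤ (9/5) B_{H+1} B_H`;
* T2 **`inv_iSup_rotStripBR_succ_le`** — `1/B_{H+1} ≤ 1/B_H + 9/5`; T3 `inv_iSup_rotStripBR_le` — `1/B_H ≤ 1/B_1 + (9/5)(H−1)`;
* T4 `pow_hexCriticalFugacity_le_rotStripBR` (`x_c^{H+1} ≤ B_{H,H+1}`, the straight bridge through the tree's dictionary),
  `sq_hexCriticalFugacity_le_iSup_rotStripBR_one` / `iSup_rotStripBR_one_le` (`x_c² ≤ B_1 ≤ x_c² + x_c³`),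
  `inv_iSup_rotStripBR_one_le` (`1/B_1 ≤ 2 + √2`);
* T5 ★ **`one_div_affine_le_iSup_rotStripBR`** — `1/((2+√2) + (9/5)(H−1)) ≤ B_H` for every `H ≥ 1`, hence
  ★ **`one_div_two_mul_succ_le_iSup_rotStripBR` — `B_H ≥ 1/(2(H+1))`** and `B_H ≥ 1/(4H)`;
* T6 `half_iSup_rotStripBR_le_succ` — `B_H / 2 ≤ B_{H+1}` (improves the tree's `x_c² B_H ≤ B_{H+1}` of
  `HexSAWRotStripSurfaceMonotone`; in fact `B_H/(1 + (9/5)B_H) ≤ B_{H+1}`), and `one_sub_ratio_le` —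
  `1 − B_{H+1}/B_H ≤ (9/5) B_{H+1}` (so the ratio tends to `1` from this side, at the tree's log rate);
* T7 `exists_width_lt_rotStripBR`, `eventually_lt_rotStripBR` — finite-width witnesses of any `r < 1/(2(H+1))`;
* T8 `sum_iSup_rotStripBR_ge`, **`tendsto_sum_iSup_rotStripBR_atTop`**, `not_summable_iSup_rotStripBR(_succ)` —
  `Σ_{H ≤ N} B_H ≥ ¼ Σ_{i ≤ N} 1/i → ∞`: the rotated-frame twin of DCS's `Z(x_c) = ∞` step;
* T9 `iSup_rotStripBR_two_sided` — with the tree's log decay (`HV.iSup_rotStripBR_le_log`, ∃C):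
  `1/(2(H+1)) ≤ B_H ≤ C (log H)^{-1/3}`;
* T10 **`rotStripBR_succ_le_self`** — MONOTONICITY IN THE HEIGHT, already at FINITE width: `B_{H+1,W} ≤ B_{H,W}` for
  `H, W ≥ 1` (two strip identities at the same width; the four other classes `A^O, A^I, P, E` of `D(H,W)` embed into those
  of `D(H+1,W)` — tree `rotGF_mono_of_imp`, `rotStripLat_mono_height`), hence **`iSup_rotStripBR_succ_le` — `B_{H+1} ≤ B_H`**
  ([Bea14] §4, arXiv v3 p. 17: «B_T(x_c, 1) must decrease as T increases»), `antitone_iSup_rotStripBR_succ`,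
  `iSup_rotStripBR_le_of_le`, the uniform ceiling `iSup_rotStripBR_le_sq_add_cube` — `B_H ≤ B_1 ≤ x_c² + x_c³ < 0.4515`
  (the tree's uniform bound was `x_c = 0.5412`), and the RATIO LAW `ratio_iSup_rotStripBR_mem_Icc` —
  `1 − (9/5) B_{H+1} ≤ B_{H+1}/B_H ≤ 1`, **`tendsto_ratio_iSup_rotStripBR` — `B_{H+1}/B_H → 1`**, with the tree's rate
  `abs_one_sub_ratio_le_log` — `|1 − B_{H+1}/B_H| ≤ (9/5) C (log(H+1))^{-1/3}`.
HONEST LABEL (for lit-1 to decide): CONSOLIDATION-BY-TRANSFER WITH EXPLICIT CONSTANTS — the [DCS12] §3 harmonic lower bound,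
run on Beaton's rotated strip identity and his last-contact cut exactly as the tree's capstone runs them at `y > y†`
(`HV.rotStripByUnbounded_holds`), here at `y = 1`; to the author's reading no lower bound for the rotated-frame `B_T(x_c)` is
in print ([Bea14] App. proves only `B_T → 0`), and the tree had only the geometric `x_c² B_H ≤ B_{H+1}`.  The constants
`9/5`, `1/(2(H+1))` are the lane's (certified, not optimal: `κ = 1.78…`, `1/B_1 ≤ 2 + √2`).
presearch: «harmonic lower bound rotated honeycomb bridges B_T ≥ c/T» → [corpus:arxiv-1210.0274 pp. 12, 17, 19–20] no lower
bound stated; [corpus:krachun2026 pp. 3, 5–6] parallel frame only («the lower bound B_T ≥ c/T was obtained in [DCS12]»);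
galaxy «rotated honeycomb|B_T \geq|bridges of height T» (all stars) 13 rows, none relevant; tree `stripBlim_ge` (parallel frame).
-/

noncomputable section

open Finset Filter Topology

namespace Literature.Probability.RandomPlanarGeometry.SAW.HV

/-! ### Numerics (folklore) -/

/-- `0 < sin(π/16)`. [folklore] -/
private theorem sin16_pos : 0 < Real.sin (Real.pi / 16) :=
  Real.sin_pos_of_pos_of_lt_pi (by positivity) (by linarith [Real.pi_pos])

/-- `0 < sin(3π/16)`. [folklore] -/
private theorem sin316_pos : 0 < Real.sin (3 * Real.pi / 16) :=
  Real.sin_pos_of_pos_of_lt_pi (by positivity) (by linarith [Real.pi_pos])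

/-- `0 < cos(π/16)`. [folklore] -/
private theorem cos16_pos : 0 < Real.cos (Real.pi / 16) :=
  Real.cos_pos_of_mem_Ioo ⟨by linarith [Real.pi_pos], by linarith [Real.pi_pos]⟩

/-- `0 < cos(3π/16)`. [folklore] -/
private theorem cos316_pos : 0 < Real.cos (3 * Real.pi / 16) :=
  Real.cos_pos_of_mem_Ioo ⟨by linarith [Real.pi_pos], by linarith [Real.pi_pos]⟩

/-- `0 < cos(7π/16)`. [folklore] -/
private theorem cos716_pos : 0 < Real.cos (7 * Real.pi / 16) :=
  Real.cos_pos_of_mem_Ioo ⟨by linarith [Real.pi_pos], by linarith [Real.pi_pos]⟩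

/-- `cos(7π/16) = sin(π/16)`. [folklore] -/
private theorem cos716_eq_sin16 : Real.cos (7 * Real.pi / 16) = Real.sin (Real.pi / 16) := by
  rw [← Real.sin_pi_div_two_sub]; congr 1; ring

/-- `sin(3π/16) = (√2/2)(cos(π/16) − sin(π/16))`. [folklore] -/
private theorem sin316_eq : Real.sin (3 * Real.pi / 16) =
    Real.sqrt 2 / 2 * (Real.cos (Real.pi / 16) - Real.sin (Real.pi / 16)) := by
  rw [show 3 * Real.pi / 16 = Real.pi / 4 - Real.pi / 16 by ring, Real.sin_sub, Real.sin_pi_div_four,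
    Real.cos_pi_div_four]
  ring

/-- `1.414213 < √2 < 1.414214`. [folklore] -/
private theorem sqrt2_bounds : (1.414213 : ℝ) < Real.sqrt 2 ∧ Real.sqrt 2 < 1.414214 := by
  constructor
  · rw [show (1.414213 : ℝ) = Real.sqrt (1.414213 ^ 2) by rw [Real.sqrt_sq]; norm_num]
    exact Real.sqrt_lt_sqrt (by norm_num) (by norm_num)
  · rw [show (1.414214 : ℝ) = Real.sqrt (1.414214 ^ 2) by rw [Real.sqrt_sq]; norm_num]
    exact Real.sqrt_lt_sqrt (by norm_num) (by norm_num)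

/-- `1.847758 < √(2 + √2) < 1.84776`. [folklore] -/
private theorem sqrt2p_bounds :
    (1.847758 : ℝ) < Real.sqrt (2 + Real.sqrt 2) ∧ Real.sqrt (2 + Real.sqrt 2) < 1.84776 := by
  obtain ⟨h1, h2⟩ := sqrt2_bounds
  constructor
  · rw [show (1.847758 : ℝ) = Real.sqrt (1.847758 ^ 2) by rw [Real.sqrt_sq]; norm_num]
    exact Real.sqrt_lt_sqrt (by norm_num) (by norm_num; linarith)
  · rw [show (1.84776 : ℝ) = Real.sqrt (1.84776 ^ 2) by rw [Real.sqrt_sq]; norm_num]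
    exact Real.sqrt_lt_sqrt (by positivity) (by norm_num; linarith)

/-- `0.54119 < x_c`. [cite: DuminilCopinSmirnov2012, Theorem 1 (μ = √(2+√2))] -/
private theorem xc_gt : (0.54119 : ℝ) < hexCriticalFugacity := by
  have hx : 0 < hexCriticalFugacity := hexCriticalFugacity_pos_lt_one.1
  obtain ⟨h1, h2⟩ := sqrt2_bounds
  have hsq := hexCriticalFugacity_sq
  nlinarith [sq_nonneg (hexCriticalFugacity - 0.54119), sq_nonneg (hexCriticalFugacity + 0.54119)]

/-- `x_c < 0.5412`. [cite: DuminilCopinSmirnov2012, Theorem 1 (μ = √(2+√2))] -/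
private theorem xc_lt : hexCriticalFugacity < 0.5412 := by
  have hx : 0 < hexCriticalFugacity := hexCriticalFugacity_pos_lt_one.1
  obtain ⟨h1, h2⟩ := sqrt2_bounds
  have hsq := hexCriticalFugacity_sq
  nlinarith [sq_nonneg (hexCriticalFugacity - 0.5412), sq_nonneg (hexCriticalFugacity + 0.5412)]

/-- `0.9807 < cos(π/16) < 0.98079`. [folklore] -/
private theorem cos16_bounds : (0.9807 : ℝ) < Real.cos (Real.pi / 16) ∧ Real.cos (Real.pi / 16) < 0.98079 := by
  obtain ⟨h3, h4⟩ := sqrt2p_bounds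
  rw [Real.cos_pi_div_sixteen]
  constructor
  · rw [show (0.9807 : ℝ) = Real.sqrt (1.9614 ^ 2) / 2 by rw [Real.sqrt_sq]; norm_num; norm_num]
    exact div_lt_div_of_pos_right (Real.sqrt_lt_sqrt (by positivity) (by nlinarith)) two_pos
  · rw [show (0.98079 : ℝ) = Real.sqrt (1.96158 ^ 2) / 2 by rw [Real.sqrt_sq]; norm_num; norm_num]
    exact div_lt_div_of_pos_right (Real.sqrt_lt_sqrt (by positivity) (by nlinarith)) two_pos

/-- `0.195 < sin(π/16) < 0.1951`. [folklore] -/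
private theorem sin16_bounds : (0.195 : ℝ) < Real.sin (Real.pi / 16) ∧ Real.sin (Real.pi / 16) < 0.1951 := by
  obtain ⟨h3, h4⟩ := sqrt2p_bounds
  rw [Real.sin_pi_div_sixteen]
  constructor
  · rw [show (0.195 : ℝ) = Real.sqrt (0.39 ^ 2) / 2 by rw [Real.sqrt_sq]; norm_num; norm_num]
    exact div_lt_div_of_pos_right (Real.sqrt_lt_sqrt (by norm_num) (by nlinarith)) two_pos
  · rw [show (0.1951 : ℝ) = Real.sqrt (0.3902 ^ 2) / 2 by rw [Real.sqrt_sq]; norm_num; norm_num]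
    refine div_lt_div_of_pos_right (Real.sqrt_lt_sqrt ?_ (by nlinarith)) two_pos
    have h5 : Real.sqrt (2 + Real.sqrt 2) < 2 := by linarith
    linarith

/-- `sin(3π/16) < 0.5557`. [folklore] -/
private theorem sin316_lt : Real.sin (3 * Real.pi / 16) < 0.5557 := by
  obtain ⟨h1, h2⟩ := sqrt2_bounds
  obtain ⟨hc1, hc2⟩ := cos16_bounds
  obtain ⟨hs1, hs2⟩ := sin16_bounds
  rw [sin316_eq]
  nlinarith

/-- ★ the lane's constant: `κ = σ/(2 x_c cos(π/16)) ≤ 9/5` (`κ = 1.78…`).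
[cite: Beaton2014RotatedHoneycomb, §2.2 Proposition 4 (the coefficients)] -/
theorem rotKappa_le : (2 * Real.sin (3 * Real.pi / 16) + 2 * Real.sin (Real.pi / 16) + 2 * Real.cos (7 * Real.pi / 16)) /
    (2 * hexCriticalFugacity * Real.cos (Real.pi / 16)) ≤ 9 / 5 := by
  obtain ⟨hc1, hc2⟩ := cos16_bounds
  obtain ⟨hs1, hs2⟩ := sin16_bounds
  have hx := xc_gt
  have h3 := sin316_lt
  have hden : 0 < 2 * hexCriticalFugacity * Real.cos (Real.pi / 16) := by
    have := hexCriticalFugacity_pos_lt_one.1; positivity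
  rw [div_le_iff₀ hden, cos716_eq_sin16]
  nlinarith

/-- `κ ≥ 0`. [cite: Beaton2014RotatedHoneycomb, §2.2 Proposition 4] -/
theorem rotKappa_nonneg : 0 ≤ (2 * Real.sin (3 * Real.pi / 16) + 2 * Real.sin (Real.pi / 16) +
    2 * Real.cos (7 * Real.pi / 16)) / (2 * hexCriticalFugacity * Real.cos (Real.pi / 16)) := by
  have := hexCriticalFugacity_pos_lt_one.1
  have := sin16_pos; have := sin316_pos; have := cos16_pos; have := cos716_pos
  positivity

/-! ### T0 — the finite-width step (two strip identities and three last-contact cuts) -/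

/-- **T0 (finite width).** For `H, W ≥ 1`:
`c_B B_{H,W} ≤ c_B B_{H+1,W} + σ x_c⁻¹ B_{H+1,W} · (⨆_{W'} B_{H,W'}) + c_E E_{H+1,W}` — subtract Beaton's strip identities of
`D(H+1, W)` and `D(H, W)`, bound the three bottom-class increments by the last-contact cut, drop `c_E E_{H,W} ≥ 0`.
[cite: Beaton2014RotatedHoneycomb, §2.2 Proposition 4 and §4 proof of Proposition 11 (arXiv v3 p. 18); DuminilCopinSmirnov2012, §3 (proof of Theorem 1)] -/
theorem rotStripBR_step_finite {H Wd : ℕ} (hH : 1 ≤ H) (hW : 1 ≤ Wd) :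
    2 * Real.cos (Real.pi / 16) * rotStripBR H Wd ≤
      2 * Real.cos (Real.pi / 16) * rotStripBR (H + 1) Wd +
        (2 * Real.sin (3 * Real.pi / 16) + 2 * Real.sin (Real.pi / 16) + 2 * Real.cos (7 * Real.pi / 16)) *
          hexCriticalFugacity⁻¹ * rotStripBR (H + 1) Wd * (⨆ W : ℕ, rotStripBR H W) +
        2 * Real.cos (3 * Real.pi / 16) * rotGF ((rotStripV (H + 1) Wd).erase wOut) (IsRotLatDart (H + 1) Wd) := by
  have hid1 := rotStrip_identity (H := H + 1) (Wd := Wd) (by omega) hW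
  have hid0 := rotStrip_identity (H := H) (Wd := Wd) hH hW
  have hcut := rot_arch_cut_iSup (H := H) hH Wd (show (0 : ℝ) ≤ 1 by norm_num)
  dsimp only at hcut
  obtain ⟨hcO, hcI, hcP⟩ := hcut
  simp only [rotGFy_one] at hcO hcI hcP
  rw [← rotStripBR_eq_rotGF (H + 1) Wd] at hcO hcI hcP hid1
  rw [← rotStripBR_eq_rotGF H Wd] at hid0
  have hE0 : 0 ≤ rotGF ((rotStripV H Wd).erase wOut) (IsRotLatDart H Wd) := rotStripLat_nonneg H Wd
  have h5 := mul_le_mul_of_nonneg_left hcO (mul_pos two_pos sin316_pos).le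
  have h6 := mul_le_mul_of_nonneg_left hcI (mul_pos two_pos sin16_pos).le
  have h7 := mul_le_mul_of_nonneg_left hcP (mul_pos two_pos cos716_pos).le
  have hσ : (2 * Real.sin (3 * Real.pi / 16) + 2 * Real.sin (Real.pi / 16) + 2 * Real.cos (7 * Real.pi / 16)) *
      hexCriticalFugacity⁻¹ * rotStripBR (H + 1) Wd * (⨆ W : ℕ, rotStripBR H W) =
      2 * Real.sin (3 * Real.pi / 16) *
          (hexCriticalFugacity⁻¹ * rotStripBR (H + 1) Wd * (⨆ W : ℕ, rotStripBR H W)) +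
        2 * Real.sin (Real.pi / 16) *
          (hexCriticalFugacity⁻¹ * rotStripBR (H + 1) Wd * (⨆ W : ℕ, rotStripBR H W)) +
        2 * Real.cos (7 * Real.pi / 16) *
          (hexCriticalFugacity⁻¹ * rotStripBR (H + 1) Wd * (⨆ W : ℕ, rotStripBR H W)) := by ring
  linarith [mul_nonneg cos316_pos.le hE0]

/-! ### T1 — the limit `W → ∞`: `B_H − B_{H+1} ≤ κ B_{H+1} B_H` -/

/-- **T1 (limit form).** `c_B B_H ≤ c_B B_{H+1} + σ x_c⁻¹ B_{H+1} B_H` for `H ≥ 1` (`W → ∞` in T0: `B_{·,W} →` its supremum,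
`E_{H+1,W} → 0` by the tree's lateral null limit). [cite: Beaton2014RotatedHoneycomb, §4, proof of Proposition 11 (arXiv v3 p. 18: the display «c_B B_T(x_c,1) − c_B(y)B_{T+1}(x_c,y) ≤ (c_A^O + c_A^I + c_P) B_{T+1}(x_c,y) B_T(x_c,1)», here y = 1; B_T = lim_L B_{T,L}; Corollary 13 at y = 1); DuminilCopinSmirnov2012, §3] -/
theorem iSup_rotStripBR_step {H : ℕ} (hH : 1 ≤ H) :
    2 * Real.cos (Real.pi / 16) * (⨆ W : ℕ, rotStripBR H W) ≤
      2 * Real.cos (Real.pi / 16) * (⨆ W : ℕ, rotStripBR (H + 1) W) +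
        (2 * Real.sin (3 * Real.pi / 16) + 2 * Real.sin (Real.pi / 16) + 2 * Real.cos (7 * Real.pi / 16)) *
          hexCriticalFugacity⁻¹ * (⨆ W : ℕ, rotStripBR (H + 1) W) * (⨆ W : ℕ, rotStripBR H W) := by
  have h0 := tendsto_rotStripBR hH
  have h1 := tendsto_rotStripBR (H := H + 1) (by omega)
  have hE := tendsto_rotStripLat_zero (H := H + 1) (by omega)
  have hlim := ((h1.const_mul (2 * Real.cos (Real.pi / 16))).add
    ((h1.const_mul ((2 * Real.sin (3 * Real.pi / 16) + 2 * Real.sin (Real.pi / 16) +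
      2 * Real.cos (7 * Real.pi / 16)) * hexCriticalFugacity⁻¹)).mul_const (⨆ W : ℕ, rotStripBR H W))).add
    (hE.const_mul (2 * Real.cos (3 * Real.pi / 16)))
  rw [mul_zero, add_zero] at hlim
  refine le_of_tendsto_of_tendsto (h0.const_mul _) hlim (eventually_atTop.2 ⟨1, fun Wd hW => ?_⟩)
  have h := rotStripBR_step_finite hH hW
  simp only
  linarith

/-- **T1. `B_H − B_{H+1} ≤ κ · B_{H+1} · B_H`** with `κ = σ/(2 x_c cos(π/16))`, `σ = 2 sin(3π/16) + 2 sin(π/16) + 2 cos(7π/16)`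
— the rotated-frame twin of DCS's `B_T − B_{T+1} ≤ c_α x_c B_{T+1}²`.
[cite: DuminilCopinSmirnov2012, §3 (proof of Theorem 1); Beaton2014RotatedHoneycomb, §4 proof of Proposition 11 (arXiv v3 p. 18)] -/
theorem iSup_rotStripBR_sub_succ_le {H : ℕ} (hH : 1 ≤ H) :
    (⨆ W : ℕ, rotStripBR H W) - (⨆ W : ℕ, rotStripBR (H + 1) W) ≤
      (2 * Real.sin (3 * Real.pi / 16) + 2 * Real.sin (Real.pi / 16) + 2 * Real.cos (7 * Real.pi / 16)) /
          (2 * hexCriticalFugacity * Real.cos (Real.pi / 16)) *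
        (⨆ W : ℕ, rotStripBR (H + 1) W) * (⨆ W : ℕ, rotStripBR H W) := by
  have hx := hexCriticalFugacity_pos_lt_one.1
  have hc := cos16_pos
  have h := iSup_rotStripBR_step hH
  obtain ⟨S0, hS0⟩ : ∃ S, S = ⨆ W : ℕ, rotStripBR H W := ⟨_, rfl⟩
  obtain ⟨S1, hS1⟩ : ∃ S, S = ⨆ W : ℕ, rotStripBR (H + 1) W := ⟨_, rfl⟩
  obtain ⟨σ, hσ⟩ : ∃ s, s = 2 * Real.sin (3 * Real.pi / 16) + 2 * Real.sin (Real.pi / 16) +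
    2 * Real.cos (7 * Real.pi / 16) := ⟨_, rfl⟩
  rw [← hS0, ← hS1, ← hσ] at h ⊢
  have hden : 0 < 2 * hexCriticalFugacity * Real.cos (Real.pi / 16) := by positivity
  rw [div_mul_eq_mul_div, div_mul_eq_mul_div, le_div_iff₀ hden]
  have key := mul_le_mul_of_nonneg_left h hx.le
  have e : hexCriticalFugacity * (2 * Real.cos (Real.pi / 16) * S1 + σ * hexCriticalFugacity⁻¹ * S1 * S0) =
      hexCriticalFugacity * (2 * Real.cos (Real.pi / 16) * S1) + σ * S1 * S0 * (hexCriticalFugacity * hexCriticalFugacity⁻¹) := by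
    ring
  rw [e, mul_inv_cancel₀ hx.ne', mul_one] at key
  linarith

/-- T1, numeral form: `B_H − B_{H+1} ≤ (9/5) · B_{H+1} · B_H` for `H ≥ 1`.
[cite: DuminilCopinSmirnov2012, §3 (proof of Theorem 1); Beaton2014RotatedHoneycomb, §4] -/
theorem iSup_rotStripBR_sub_succ_le_numeral {H : ℕ} (hH : 1 ≤ H) :
    (⨆ W : ℕ, rotStripBR H W) - (⨆ W : ℕ, rotStripBR (H + 1) W) ≤
      9 / 5 * (⨆ W : ℕ, rotStripBR (H + 1) W) * (⨆ W : ℕ, rotStripBR H W) := by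
  have h := iSup_rotStripBR_sub_succ_le hH
  have hk := rotKappa_le
  have h0 : 0 ≤ (⨆ W : ℕ, rotStripBR (H + 1) W) * (⨆ W : ℕ, rotStripBR H W) :=
    mul_nonneg (iSup_rotStripBR_pos (by omega)).le (iSup_rotStripBR_pos hH).le
  have := mul_le_mul_of_nonneg_right hk h0
  linarith [mul_assoc ((2 * Real.sin (3 * Real.pi / 16) + 2 * Real.sin (Real.pi / 16) +
    2 * Real.cos (7 * Real.pi / 16)) / (2 * hexCriticalFugacity * Real.cos (Real.pi / 16)))
    (⨆ W : ℕ, rotStripBR (H + 1) W) (⨆ W : ℕ, rotStripBR H W),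
    mul_assoc (9 / 5 : ℝ) (⨆ W : ℕ, rotStripBR (H + 1) W) (⨆ W : ℕ, rotStripBR H W)]

/-! ### T2–T3 — the reciprocal grows at most linearly -/

/-- **T2. `1/B_{H+1} ≤ 1/B_H + 9/5`** for `H ≥ 1`. [cite: DuminilCopinSmirnov2012, §3 (proof of Theorem 1: "B_T ≥ min[B_1, 1/(c_α x_c)]/T")] -/
theorem inv_iSup_rotStripBR_succ_le {H : ℕ} (hH : 1 ≤ H) :
    (⨆ W : ℕ, rotStripBR (H + 1) W)⁻¹ ≤ (⨆ W : ℕ, rotStripBR H W)⁻¹ + 9 / 5 := by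
  have hS0 := iSup_rotStripBR_pos hH
  have hS1 := iSup_rotStripBR_pos (H := H + 1) (by omega)
  have h := iSup_rotStripBR_sub_succ_le_numeral hH
  have key : (⨆ W : ℕ, rotStripBR (H + 1) W)⁻¹ - (⨆ W : ℕ, rotStripBR H W)⁻¹ ≤ 9 / 5 := by
    rw [inv_sub_inv hS1.ne' hS0.ne', div_le_iff₀ (mul_pos hS1 hS0)]
    linarith
  linarith

/-- **T3. `1/B_H ≤ 1/B_1 + (9/5)(H − 1)`** for `H ≥ 1`. [cite: DuminilCopinSmirnov2012, §3 (proof of Theorem 1)] -/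
theorem inv_iSup_rotStripBR_le {H : ℕ} (hH : 1 ≤ H) :
    (⨆ W : ℕ, rotStripBR H W)⁻¹ ≤ (⨆ W : ℕ, rotStripBR 1 W)⁻¹ + 9 / 5 * ((H : ℝ) - 1) := by
  induction H, hH using Nat.le_induction with
  | base => simp
  | succ n hn ih =>
    have h := inv_iSup_rotStripBR_succ_le hn
    push_cast at ih ⊢
    linarith

/-! ### T4 — height one and the straight bridge -/

/-- `x_c^{H+1} ≤ B_{H,H+1}` for `H ≥ 1`: the straight brick-wall bridge of `H` steps (span `H`) through the tree's dictionary
`HexBW.rot_dictionary`, and `μ = x_c⁻¹`. [cite: Beaton2014RotatedHoneycomb, §2–§3 (PP-bridges of height T); MadrasSlade1993, §1.2; DuminilCopinSmirnov2012, Theorem 1] -/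
theorem pow_hexCriticalFugacity_le_rotStripBR {H : ℕ} (hH : 1 ≤ H) :
    hexCriticalFugacity ^ (H + 1) ≤ rotStripBR H (H + 1) := by
  classical
  have hx := hexCriticalFugacity_pos_lt_one
  have hμ : 0 < hexConnectiveConstant := hexConnectiveConstant_pos
  have hmem : Zd.straightWalk 2 H ∈ HexBW.brSpan H (H : ℤ) := by
    refine Finset.mem_filter.2 ⟨HexBW.straightWalk_mem_bridges H, ?_⟩
    simp [Zd.straightWalk]
  have hcard : (1 : ℝ) ≤ (#(HexBW.brSpan H (H : ℤ)) : ℝ) := by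
    exact_mod_cast Finset.one_le_card.2 ⟨_, hmem⟩
  have hsum : (#(HexBW.brSpan H (H : ℤ)) : ℝ) / hexConnectiveConstant ^ H ≤
      ∑ m ∈ range (H + 1), (#(HexBW.brSpan m (H : ℤ)) : ℝ) / hexConnectiveConstant ^ m :=
    Finset.single_le_sum (f := fun m => (#(HexBW.brSpan m (H : ℤ)) : ℝ) / hexConnectiveConstant ^ m)
      (fun m _ => div_nonneg (Nat.cast_nonneg _) (pow_nonneg hμ.le _)) (Finset.mem_range.2 (Nat.lt_succ_self H))
  have hdict := HexBW.rot_dictionary H (H + 1) hH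
  have h1 : 1 / hexConnectiveConstant ^ H ≤ hexCriticalFugacity⁻¹ * rotStripBR H (H + 1) :=
    calc 1 / hexConnectiveConstant ^ H ≤ (#(HexBW.brSpan H (H : ℤ)) : ℝ) / hexConnectiveConstant ^ H :=
          div_le_div_of_nonneg_right hcard (pow_pos hμ _).le
      _ ≤ _ := hsum.trans hdict
  rw [hexConnectiveConstant_eq_inv, inv_pow, one_div, inv_inv] at h1
  have hx0 : hexCriticalFugacity ≠ 0 := hx.1.ne'
  calc hexCriticalFugacity ^ (H + 1) = hexCriticalFugacity ^ H * hexCriticalFugacity := pow_succ _ _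
    _ ≤ hexCriticalFugacity⁻¹ * rotStripBR H (H + 1) * hexCriticalFugacity := mul_le_mul_of_nonneg_right h1 hx.1.le
    _ = rotStripBR H (H + 1) := by field_simp

/-- `x_c^{H+1} ≤ B_H` for `H ≥ 1` (geometric lower bound; superseded by T5 below). [cite: Beaton2014RotatedHoneycomb, §2–§3] -/
theorem pow_hexCriticalFugacity_le_iSup_rotStripBR {H : ℕ} (hH : 1 ≤ H) :
    hexCriticalFugacity ^ (H + 1) ≤ ⨆ W : ℕ, rotStripBR H W :=
  (pow_hexCriticalFugacity_le_rotStripBR hH).trans (rotStripBR_le_iSup hH (H + 1))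

/-- `x_c² ≤ B_1`. [cite: Beaton2014RotatedHoneycomb, §2.2 (D_{T,L})] -/
theorem sq_hexCriticalFugacity_le_iSup_rotStripBR_one : hexCriticalFugacity ^ 2 ≤ ⨆ W : ℕ, rotStripBR 1 W :=
  pow_hexCriticalFugacity_le_iSup_rotStripBR le_rfl

/-- `B_1 ≤ x_c² + x_c³` (the height-one strip has two top walks — tree `rotStripBRy_one_le` at `y = 1`).
[cite: Beaton2014RotatedHoneycomb, §2.2 (D_{T,L})] -/
theorem iSup_rotStripBR_one_le : (⨆ W : ℕ, rotStripBR 1 W) ≤ hexCriticalFugacity ^ 2 + hexCriticalFugacity ^ 3 := by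
  refine ciSup_le fun Wd => ?_
  have h := rotStripBRy_one_le Wd (show (0 : ℝ) ≤ 1 by norm_num)
  rw [rotStripBRy, rotGFy_one, ← rotStripBR_eq_rotGF] at h
  simpa using h

/-- `1/B_1 ≤ 2 + √2` (`x_c² = 1/(2+√2)`). [cite: DuminilCopinSmirnov2012, Theorem 1; Beaton2014RotatedHoneycomb, §2.2] -/
theorem inv_iSup_rotStripBR_one_le : (⨆ W : ℕ, rotStripBR 1 W)⁻¹ ≤ 2 + Real.sqrt 2 := by
  have hx := hexCriticalFugacity_pos_lt_one.1
  have h := sq_hexCriticalFugacity_le_iSup_rotStripBR_one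
  have hinv : (hexCriticalFugacity ^ 2)⁻¹ = 2 + Real.sqrt 2 := inv_eq_of_mul_eq_one_right hexCriticalFugacity_sq
  rw [← hinv]
  exact inv_anti₀ (pow_pos hx 2) h

/-! ### T5 — the harmonic lower bound -/

/-- ★ **T5. `1/((2+√2) + (9/5)(H−1)) ≤ B_H` for every `H ≥ 1`.**
[cite: DuminilCopinSmirnov2012, §3 (proof of Theorem 1: "B_T ≥ min[B_1, 1/(c_α x_c)]/T"); Beaton2014RotatedHoneycomb, §4 and Appendix Theorem 14 (only B_T → 0 in print)] -/
theorem one_div_affine_le_iSup_rotStripBR {H : ℕ} (hH : 1 ≤ H) :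
    1 / (2 + Real.sqrt 2 + 9 / 5 * ((H : ℝ) - 1)) ≤ ⨆ W : ℕ, rotStripBR H W := by
  have hS := iSup_rotStripBR_pos hH
  have h1 := inv_iSup_rotStripBR_le hH
  have h2 := inv_iSup_rotStripBR_one_le
  have hH' : (1 : ℝ) ≤ H := by exact_mod_cast hH
  have hD : 0 < 2 + Real.sqrt 2 + 9 / 5 * ((H : ℝ) - 1) := by
    have := Real.sqrt_nonneg 2; nlinarith
  rw [one_div]
  exact inv_le_of_inv_le₀ hS (by linarith)

/-- ★★ **T5, numeral: `B_H ≥ 1/(2(H+1))` for every `H ≥ 1`** — the polynomial lower bound on Beaton's rotated-frame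
critical bridge generating function (to be read against the tree's `B_H ≤ C (log H)^{-1/3}`).
[cite: DuminilCopinSmirnov2012, §3 (proof of Theorem 1); Beaton2014RotatedHoneycomb, Appendix Theorem 14] -/
theorem one_div_two_mul_succ_le_iSup_rotStripBR {H : ℕ} (hH : 1 ≤ H) :
    1 / (2 * ((H : ℝ) + 1)) ≤ ⨆ W : ℕ, rotStripBR H W := by
  have h := one_div_affine_le_iSup_rotStripBR hH
  have hH' : (1 : ℝ) ≤ H := by exact_mod_cast hH
  obtain ⟨_, h2⟩ := sqrt2_bounds
  have hD : 0 < 2 + Real.sqrt 2 + 9 / 5 * ((H : ℝ) - 1) := by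
    have := Real.sqrt_nonneg 2; nlinarith
  exact (one_div_le_one_div_of_le hD (by nlinarith)).trans h

/-- `B_H ≥ 1/(4H)` for `H ≥ 1`. [cite: DuminilCopinSmirnov2012, §3 (proof of Theorem 1)] -/
theorem one_div_four_mul_le_iSup_rotStripBR {H : ℕ} (hH : 1 ≤ H) :
    1 / (4 * (H : ℝ)) ≤ ⨆ W : ℕ, rotStripBR H W := by
  have h := one_div_two_mul_succ_le_iSup_rotStripBR hH
  have hH' : (1 : ℝ) ≤ H := by exact_mod_cast hH
  exact (one_div_le_one_div_of_le (by positivity) (by nlinarith)).trans h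

/-! ### T6 — one step costs at most a factor two -/

/-- `B_H / (1 + (9/5) B_H) ≤ B_{H+1}` for `H ≥ 1`. [cite: DuminilCopinSmirnov2012, §3 (proof of Theorem 1)] -/
theorem iSup_rotStripBR_div_le_succ {H : ℕ} (hH : 1 ≤ H) :
    (⨆ W : ℕ, rotStripBR H W) / (1 + 9 / 5 * (⨆ W : ℕ, rotStripBR H W)) ≤ ⨆ W : ℕ, rotStripBR (H + 1) W := by
  have hS0 := iSup_rotStripBR_pos hH
  have h := iSup_rotStripBR_sub_succ_le_numeral hH
  rw [div_le_iff₀ (by positivity)]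
  nlinarith

/-- **T6. `B_H / 2 ≤ B_{H+1}`** for `H ≥ 1` (`(9/5) B_H ≤ (9/5) x_c < 1`) — improves the tree's `x_c² B_H ≤ B_{H+1}`
(`HexSAWRotStripSurfaceMonotone`). [cite: DuminilCopinSmirnov2012, §3; Beaton2014RotatedHoneycomb, §3 (B_{T,L} ≤ x_c)] -/
theorem half_iSup_rotStripBR_le_succ {H : ℕ} (hH : 1 ≤ H) :
    (⨆ W : ℕ, rotStripBR H W) / 2 ≤ ⨆ W : ℕ, rotStripBR (H + 1) W := by
  have hS0 := iSup_rotStripBR_pos hH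
  have hS1 := iSup_rotStripBR_pos (H := H + 1) (by omega)
  have hxc := iSup_rotStripBR_le_xc hH
  have h := iSup_rotStripBR_sub_succ_le_numeral hH
  have h1 : (⨆ W : ℕ, rotStripBR (H + 1) W) * (⨆ W : ℕ, rotStripBR H W) ≤
      (⨆ W : ℕ, rotStripBR (H + 1) W) * hexCriticalFugacity := mul_le_mul_of_nonneg_left hxc hS1.le
  have h2 : (⨆ W : ℕ, rotStripBR (H + 1) W) * hexCriticalFugacity ≤ (⨆ W : ℕ, rotStripBR (H + 1) W) * 0.5412 :=
    mul_le_mul_of_nonneg_left xc_lt.le hS1.le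
  linarith [mul_assoc (9 / 5 : ℝ) (⨆ W : ℕ, rotStripBR (H + 1) W) (⨆ W : ℕ, rotStripBR H W)]

/-- `1 − B_{H+1}/B_H ≤ (9/5) B_{H+1}` for `H ≥ 1`: the ratio of consecutive heights tends to `1` from below at least as fast as
`B_{H+1} → 0` (tree: `≤ C (log H)^{-1/3}`). [cite: DuminilCopinSmirnov2012, §3; GlazmanManolescu2019, Proposition 1.1] -/
theorem one_sub_ratio_le {H : ℕ} (hH : 1 ≤ H) :
    1 - (⨆ W : ℕ, rotStripBR (H + 1) W) / (⨆ W : ℕ, rotStripBR H W) ≤ 9 / 5 * (⨆ W : ℕ, rotStripBR (H + 1) W) := by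
  have hS0 := iSup_rotStripBR_pos hH
  have h := iSup_rotStripBR_sub_succ_le_numeral hH
  rw [sub_le_iff_le_add, ← sub_le_iff_le_add', le_div_iff₀ hS0]
  linarith

/-! ### T7 — finite-width witnesses -/

/-- Every `r < 1/(2(H+1))` is beaten by some finite width: `∃ W, r < B_{H,W}` (`H ≥ 1`).
[cite: Beaton2014RotatedHoneycomb, §4 (B_T = lim_L B_{T,L})] -/
theorem exists_width_lt_rotStripBR {H : ℕ} (hH : 1 ≤ H) {r : ℝ} (hr : r < 1 / (2 * ((H : ℝ) + 1))) :
    ∃ Wd : ℕ, r < rotStripBR H Wd :=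
  exists_lt_of_lt_ciSup (hr.trans_le (one_div_two_mul_succ_le_iSup_rotStripBR hH))

/-- … and then by all larger widths (`W ↦ B_{H,W}` is non-decreasing). [cite: Beaton2014RotatedHoneycomb, §4 (B_{T,L} increasing in L)] -/
theorem eventually_lt_rotStripBR {H : ℕ} (hH : 1 ≤ H) {r : ℝ} (hr : r < 1 / (2 * ((H : ℝ) + 1))) :
    ∀ᶠ Wd : ℕ in atTop, r < rotStripBR H Wd := by
  obtain ⟨W₀, hW₀⟩ := exists_width_lt_rotStripBR hH hr
  exact eventually_atTop.2 ⟨W₀, fun Wd hWd => hW₀.trans_le (rotStripBR_monotone H hWd)⟩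

/-! ### T8 — divergence of `Σ_H B_H` (the rotated-frame twin of DCS's `Z(x_c) = ∞` step) -/

/-- `¼ Σ_{i<N} 1/(i+1) ≤ Σ_{i<N} B_{i+1}`. [cite: DuminilCopinSmirnov2012, §3 (proof of Theorem 1, Z(x_c) = ∞)] -/
theorem sum_iSup_rotStripBR_ge (N : ℕ) :
    1 / 4 * ∑ i ∈ range N, 1 / ((i : ℝ) + 1) ≤ ∑ i ∈ range N, ⨆ W : ℕ, rotStripBR (i + 1) W := by
  rw [mul_sum]
  refine sum_le_sum fun i _ => ?_
  have h := one_div_four_mul_le_iSup_rotStripBR (H := i + 1) (by omega)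
  push_cast at h
  rw [one_div_mul_one_div]
  exact h

/-- **T8. `Σ_{H=1}^{N} B_H → ∞`.** [cite: DuminilCopinSmirnov2012, §3 (proof of Theorem 1, Z(x_c) = ∞)] -/
theorem tendsto_sum_iSup_rotStripBR_atTop :
    Tendsto (fun N : ℕ => ∑ i ∈ range N, ⨆ W : ℕ, rotStripBR (i + 1) W) atTop atTop :=
  tendsto_atTop_mono sum_iSup_rotStripBR_ge
    (Real.tendsto_sum_range_one_div_nat_succ_atTop.const_mul_atTop (by norm_num))

/-- `(B_{H+1})_H` is not summable. [cite: DuminilCopinSmirnov2012, §3 (proof of Theorem 1, Z(x_c) = ∞)] -/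
theorem not_summable_iSup_rotStripBR_succ : ¬ Summable (fun H : ℕ => ⨆ W : ℕ, rotStripBR (H + 1) W) := fun hs =>
  not_tendsto_atTop_of_tendsto_nhds hs.tendsto_sum_tsum_nat tendsto_sum_iSup_rotStripBR_atTop

/-- `(B_H)_H` is not summable. [cite: DuminilCopinSmirnov2012, §3 (proof of Theorem 1, Z(x_c) = ∞)] -/
theorem not_summable_iSup_rotStripBR : ¬ Summable (fun H : ℕ => ⨆ W : ℕ, rotStripBR H W) := fun hs =>
  not_summable_iSup_rotStripBR_succ ((summable_nat_add_iff 1).2 hs)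

/-! ### T9 — two-sided, with the tree's logarithmic decay -/

/-- **T9. `1/(2(H+1)) ≤ B_H ≤ C (log H)^{-1/3}`** for `H ≥ 2` (upper side: tree `HV.iSup_rotStripBR_le_log`, ∃C; the lane's
HOME door «ROT-LOGDECAY-EXPLICIT» certifies `C = 21`). [cite: DuminilCopinSmirnov2012, §3; GlazmanManolescu2019, Proposition 1.1; Beaton2014RotatedHoneycomb, Appendix Theorem 14] -/
theorem iSup_rotStripBR_two_sided : ∃ C : ℝ, ∀ H : ℕ, 2 ≤ H →
    1 / (2 * ((H : ℝ) + 1)) ≤ (⨆ W : ℕ, rotStripBR H W) ∧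
      (⨆ W : ℕ, rotStripBR H W) ≤ C * Real.log H ^ (-(1 : ℝ) / 3) := by
  obtain ⟨C, hC⟩ := iSup_rotStripBR_le_log
  exact ⟨C, fun H hH => ⟨one_div_two_mul_succ_le_iSup_rotStripBR (by omega), hC H hH⟩⟩


/-! ### T10 — monotonicity in the height (finite width and limit) and the ratio law `B_{H+1}/B_H → 1` -/

/-- **T10 (finite width). `B_{H+1,W} ≤ B_{H,W}`** for `H, W ≥ 1`: subtract the strip identities of `D(H,W)` and `D(H+1,W)`;
every other class of `D(H,W)` (`A^O`, `A^I`, `P`, and the lateral class `E`) embeds into the same class of `D(H+1,W)`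
(tree `rotGF_mono_of_imp`, `rotStripLat_mono_height`), so `c_B (B_{H+1,W} − B_{H,W}) ≤ 0`.
[cite: Beaton2014RotatedHoneycomb, §4 (arXiv v3 p. 17: «A_T^O(x_c,1), A_T^I(x_c,1) and P_T(x_c,1) all increase with T … Then B_T(x_c,1) must decrease as T increases»); DuminilCopinSmirnov2012, §3 (B_T decreasing, parallel frame)] -/
theorem rotStripBR_succ_le_self {H Wd : ℕ} (hH : 1 ≤ H) (hW : 1 ≤ Wd) : rotStripBR (H + 1) Wd ≤ rotStripBR H Wd := by
  have hid1 := rotStrip_identity (H := H + 1) (Wd := Wd) (by omega) hW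
  have hid0 := rotStrip_identity (H := H) (Wd := Wd) hH hW
  rw [← rotStripBR_eq_rotGF (H + 1) Wd] at hid1
  rw [← rotStripBR_eq_rotGF H Wd] at hid0
  have hV : (rotStripV H Wd).erase wOut ⊆ (rotStripV (H + 1) Wd).erase wOut :=
    erase_subset_erase _ (rotStripV_mono_height (Nat.le_succ H))
  have hO := rotGF_mono_of_imp hV IsRotBotOut IsRotBotOut fun _ h => h
  have hI := rotGF_mono_of_imp hV IsRotBotIn IsRotBotIn fun _ h => h
  have hP := rotGF_mono_of_imp hV IsRotCloseDart IsRotCloseDart fun _ h => h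
  have hE := rotStripLat_mono_height (Nat.le_succ H) Wd
  have h5 := mul_le_mul_of_nonneg_left hO (mul_pos two_pos sin316_pos).le
  have h6 := mul_le_mul_of_nonneg_left hI (mul_pos two_pos sin16_pos).le
  have h7 := mul_le_mul_of_nonneg_left hP (mul_pos two_pos cos716_pos).le
  have h8 := mul_le_mul_of_nonneg_left hE (mul_pos two_pos cos316_pos).le
  have hcB : 0 < 2 * Real.cos (Real.pi / 16) := mul_pos two_pos cos16_pos
  have h9 : 2 * Real.cos (Real.pi / 16) * rotStripBR (H + 1) Wd ≤ 2 * Real.cos (Real.pi / 16) * rotStripBR H Wd := by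
    linarith
  exact le_of_mul_le_mul_left h9 hcB

/-- `B_{H',W} ≤ B_{H,W}` for `1 ≤ H ≤ H'`, `W ≥ 1`. [cite: Beaton2014RotatedHoneycomb, §4 (arXiv v3 p. 17: B_T(x_c,1) decreasing in T)] -/
theorem rotStripBR_le_of_height_le {H H' Wd : ℕ} (hH : 1 ≤ H) (h : H ≤ H') (hW : 1 ≤ Wd) :
    rotStripBR H' Wd ≤ rotStripBR H Wd := by
  induction H', h using Nat.le_induction with
  | base => exact le_rfl
  | succ H' hHH' ih => exact (rotStripBR_succ_le_self (hH.trans hHH') hW).trans ih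

/-- **T10. `B_{H+1} ≤ B_H`** for `H ≥ 1` (suprema over the width). [cite: Beaton2014RotatedHoneycomb, §4 (arXiv v3 p. 17: «Then B_T(x_c,1) must decrease as T increases, and it too has a limit as T → ∞»)] -/
theorem iSup_rotStripBR_succ_le {H : ℕ} (hH : 1 ≤ H) :
    (⨆ W : ℕ, rotStripBR (H + 1) W) ≤ ⨆ W : ℕ, rotStripBR H W := by
  refine ciSup_le fun Wd => ?_
  rcases Nat.eq_zero_or_pos Wd with rfl | hW
  · exact ((rotStripBR_monotone (H + 1) (Nat.zero_le 1)).trans (rotStripBR_succ_le_self hH le_rfl)).trans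
      (rotStripBR_le_iSup hH 1)
  · exact (rotStripBR_succ_le_self hH hW).trans (rotStripBR_le_iSup hH Wd)

/-- `H ↦ B_{H+1}` is antitone. [cite: Beaton2014RotatedHoneycomb, §4 (arXiv v3 p. 17)] -/
theorem antitone_iSup_rotStripBR_succ : Antitone fun H : ℕ => ⨆ W : ℕ, rotStripBR (H + 1) W :=
  antitone_nat_of_succ_le fun H => iSup_rotStripBR_succ_le (by omega)

/-- `B_{H'} ≤ B_H` for `1 ≤ H ≤ H'`. [cite: Beaton2014RotatedHoneycomb, §4 (arXiv v3 p. 17)] -/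
theorem iSup_rotStripBR_le_of_le {H H' : ℕ} (hH : 1 ≤ H) (h : H ≤ H') :
    (⨆ W : ℕ, rotStripBR H' W) ≤ ⨆ W : ℕ, rotStripBR H W := by
  have := antitone_iSup_rotStripBR_succ (show H - 1 ≤ H' - 1 by omega)
  simp only at this
  rwa [Nat.sub_add_cancel (hH.trans h), Nat.sub_add_cancel hH] at this

/-- The uniform ceiling `B_H ≤ B_1 ≤ x_c² + x_c³` (`H ≥ 1`; the tree's uniform bound was `x_c`).
[cite: Beaton2014RotatedHoneycomb, §4 (arXiv v3 p. 17: B_T decreasing) and §3.2 (height one)] -/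
theorem iSup_rotStripBR_le_sq_add_cube {H : ℕ} (hH : 1 ≤ H) :
    (⨆ W : ℕ, rotStripBR H W) ≤ hexCriticalFugacity ^ 2 + hexCriticalFugacity ^ 3 :=
  (iSup_rotStripBR_le_of_le le_rfl hH).trans iSup_rotStripBR_one_le

/-- … numerically `B_H < 0.4515` for every `H ≥ 1` (`x_c² + x_c³ = 0.45140…`).
[cite: Beaton2014RotatedHoneycomb, §4 (arXiv v3 p. 17: B_T decreasing) and §3.2 (height one); lane numeral] -/
theorem iSup_rotStripBR_lt_numeral {H : ℕ} (hH : 1 ≤ H) : (⨆ W : ℕ, rotStripBR H W) < 0.4515 := by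
  have h := iSup_rotStripBR_le_sq_add_cube hH
  have hx0 := hexCriticalFugacity_pos_lt_one.1
  have hx := xc_lt
  have h2 : hexCriticalFugacity ^ 2 < 0.5412 ^ 2 := by nlinarith
  have h3 : hexCriticalFugacity ^ 3 < 0.5412 ^ 3 := by nlinarith
  nlinarith

/-- Every finite-width value lies below `B_1 ≤ x_c² + x_c³`: `B_{H,W} ≤ x_c² + x_c³` (`H ≥ 1`). [cite: Beaton2014RotatedHoneycomb, §4 (arXiv v3 p. 17)] -/
theorem rotStripBR_le_sq_add_cube {H : ℕ} (hH : 1 ≤ H) (Wd : ℕ) :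
    rotStripBR H Wd ≤ hexCriticalFugacity ^ 2 + hexCriticalFugacity ^ 3 :=
  (rotStripBR_le_iSup hH Wd).trans (iSup_rotStripBR_le_sq_add_cube hH)

/-- **The ratio law.** `1 − (9/5) B_{H+1} ≤ B_{H+1}/B_H ≤ 1` for `H ≥ 1`. [cite: DuminilCopinSmirnov2012, §3; Beaton2014RotatedHoneycomb, §4 (arXiv v3 pp. 17–18)] -/
theorem ratio_iSup_rotStripBR_mem_Icc {H : ℕ} (hH : 1 ≤ H) :
    (⨆ W : ℕ, rotStripBR (H + 1) W) / (⨆ W : ℕ, rotStripBR H W) ∈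
      Set.Icc (1 - 9 / 5 * ⨆ W : ℕ, rotStripBR (H + 1) W) 1 := by
  refine ⟨by linarith [one_sub_ratio_le hH], ?_⟩
  exact div_le_one_of_le₀ (iSup_rotStripBR_succ_le hH) (iSup_rotStripBR_pos hH).le

/-- `|1 − B_{H+1}/B_H| ≤ (9/5) B_{H+1}` for `H ≥ 1`. [cite: DuminilCopinSmirnov2012, §3; Beaton2014RotatedHoneycomb, §4 (arXiv v3 pp. 17–18)] -/
theorem abs_one_sub_ratio_le {H : ℕ} (hH : 1 ≤ H) :
    |1 - (⨆ W : ℕ, rotStripBR (H + 1) W) / (⨆ W : ℕ, rotStripBR H W)| ≤ 9 / 5 * ⨆ W : ℕ, rotStripBR (H + 1) W := by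
  obtain ⟨h1, h2⟩ := ratio_iSup_rotStripBR_mem_Icc hH
  rw [abs_le]
  constructor <;> linarith [(iSup_rotStripBR_pos (H := H + 1) (by omega)).le]

/-- **`B_{H+2}/B_{H+1} → 1`** as `H → ∞` (squeezed between `1 − (9/5) B_{H+2} → 1` and `1`).
[cite: DuminilCopinSmirnov2012, §3; Beaton2014RotatedHoneycomb, §4 and Appendix Corollary 15 (B_T(x_c) → 0)] -/
theorem tendsto_ratio_iSup_rotStripBR :
    Tendsto (fun H : ℕ => (⨆ W : ℕ, rotStripBR (H + 2) W) / ⨆ W : ℕ, rotStripBR (H + 1) W) atTop (𝓝 1) := by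
  have h0 : Tendsto (fun H : ℕ => ⨆ W : ℕ, rotStripBR (H + 2) W) atTop (𝓝 0) :=
    tendsto_iSup_rotStripBR.comp (tendsto_add_atTop_nat 2)
  have h1 : Tendsto (fun H : ℕ => 1 - 9 / 5 * ⨆ W : ℕ, rotStripBR (H + 2) W) atTop (𝓝 1) := by
    have := (h0.const_mul (9 / 5 : ℝ)).const_sub 1
    simpa using this
  refine tendsto_of_tendsto_of_tendsto_of_le_of_le h1 tendsto_const_nhds (fun H => ?_) fun H => ?_
  · exact (ratio_iSup_rotStripBR_mem_Icc (H := H + 1) (by omega)).1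
  · exact (ratio_iSup_rotStripBR_mem_Icc (H := H + 1) (by omega)).2

/-- … at the tree's rate: `|1 − B_{H+1}/B_H| ≤ (9/5) C (log(H+1))^{-1/3}` for `H ≥ 1`, `C` the tree's log-decay constant
(`HV.iSup_rotStripBR_le_log`; the HOME door «ROT-LOGDECAY-EXPLICIT» certifies `C = 21`).
[cite: GlazmanManolescu2019, Proposition 1.1; Beaton2014RotatedHoneycomb, §4] -/
theorem abs_one_sub_ratio_le_log : ∃ C : ℝ, ∀ H : ℕ, 1 ≤ H →
    |1 - (⨆ W : ℕ, rotStripBR (H + 1) W) / (⨆ W : ℕ, rotStripBR H W)| ≤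
      9 / 5 * C * Real.log ((H : ℝ) + 1) ^ (-(1 : ℝ) / 3) := by
  obtain ⟨C, hC⟩ := iSup_rotStripBR_le_log
  refine ⟨C, fun H hH => (abs_one_sub_ratio_le hH).trans ?_⟩
  have h := hC (H + 1) (by omega)
  push_cast at h
  rw [mul_assoc]
  exact mul_le_mul_of_nonneg_left h (by norm_num)

end Literature.Probability.RandomPlanarGeometry.SAW.HV
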